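import Literature.AnabelianGeometry.SemiGraphs.TemperedPiBranchStabilizerImage
import Literature.AnabelianGeometry.SemiGraphs.TemperedPiPointSeqThroughVertex
import Literature.AnabelianGeometry.SemiGraphs.TemperedPiRayApartment
import Literature.AnabelianGeometry.SemiGraphs.ThetaRayGraph
import HarnessLib

/-!
# The `hstab` binder at `𝒢_θ`: branch stabilisers at a level-tree vertex of the ray ([SemiAnbd] Rmk 2.2.1, Thm 3.7 (iii))

Mochizuki, *Semi-graphs of anabelioids*, Publ. RIMS **42** (2006) [MochizukiSemiAnbd2006], Remark 2.2.1
p. 24 and the proof of Theorem 3.7 (iii) p. 41 (the sub-joint step); desk countermodel `𝒢_θ` of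
abc-iut-L3-d1 (memo HOME/staging/L3/L3-d1/g3/COUNTERMODEL-Thm37iii-infinite.md, (2c) "Bass–Serre local
structure: the stabilisers of the edges at `ỹ` over `e_m` / over `e_{m−1}` are the conjugates of `Ē_m⁻` /
`Ē_{m−1}⁺`"). [cite: MochizukiSemiAnbd2006, Rmk 2.2.1 p.24]

PROOF-ONLY file (abc-iut cell, FRONTIER programme REFUTE-F1732, glue for abc-iut-L3-d4's (hcrit) producer;
seat abc-iut-L3-t11 gen 3; no definitions, no named facts).  abc-iut-L3-t11's generic local
branch-stabiliser lemma `PointSeq.exists_gal_conj_brHom_of_edgeMap_eq` (`TemperedPiBranchStabilizerImage.lean`)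
SPECIALISED to the binder-form graph `thetaRay G E up low` and put in EXACTLY the shape of the hypothesis
`hstab` of abc-iut-L3-d4's `SemiGraph.ray_not_critical_of_characters` (`ThetaRayCriticalSubjoint.lean`):
for any Galois tower `D` of `thetaRay G E up low`, a point sequence `P` over `w`, a level `j` and
`g ∈ π₁^temp`, with `Γ := Gal(𝒢_{∞,j}/𝒢)`, `σ := ρ_j g`, `ψ := ρ_j ∘ P.decompHom : G →* Γ`,
`T := 𝔾̃_j`, `π := 𝔾̃_j → ray`, `σT := treeAct_j g`:

* `thetaRay_hstab` — every branch `b` of `𝔾̃_j` at `P.vertex j` whose edge is fixed by `g` gives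
  `σ = ψ (f · (if (π b).2 then up t else low (π b).1 t) · f⁻¹)` for some `f ∈ G`, `t ∈ E`;
* `thetaRay_hstab_of_vertex` — the same at an ARBITRARY tree vertex `y` over `w`, for SOME point sequence
  through `y` (abc-iut-L3-t11's `PointSeq.exists_pointSeq_vertex_eq_of_treeProj`), given one point sequence
  `P₀` over `w`.

Towards a kernel erratum for the ∀-countable reading of [SemiAnbd] Thm 3.7 (iii) ([IUTchI] Rmk 2.5.3); print
proves finite `𝔾` (kernel: `compactInVerticialAt_of_finiteGraph`).  Nothing here bears on [IUTchIII] Cor. 3.12;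
typed ≠ proved.
-/

namespace Literature.AnabelianGeometry.SemiGraphs

open CategoryTheory Topology
open ProfiniteSemiGraph ProfiniteSemiGraph.GaloisLevelData

universe u

variable {G E : Type} [Group G] [TopologicalSpace G] [IsTopologicalGroup G] [CompactSpace G]
  [TotallyDisconnectedSpace G] [Group E] [TopologicalSpace E] [IsTopologicalGroup E] [CompactSpace E]
  [TotallyDisconnectedSpace E] {up : E →ₜ* G} {low : ℕ → (E →ₜ* G)}
  {D : GaloisLevelData (thetaRay G E up low)} {h𝒢 : (thetaRay G E up low).IsCountable}

/-- The gluing of `thetaRay` along a branch `β`, applied, in the `if … then up t else low β.1 t` shape with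
bundled `MonoidHom`s. [cite: MochizukiSemiAnbd2006, Def 2.1 p.22] -/
theorem thetaRay_brHom_apply_eq_ite (β : ℕ × Bool) (v : ℕ) (h : SemiGraph.ray.abuts β = some v) (t : E) :
    (thetaRay G E up low).brHom β v h t =
      (if β.2 then up.toMonoidHom t else (low β.1).toMonoidHom t) := by
  rw [thetaRay_brHom]
  split_ifs <;> rfl

/-- **`hstab` at `𝒢_θ`**: for a point sequence `P` over `w` of a Galois tower of `thetaRay G E up low`, a
level `j` and `g ∈ π₁^temp`, every branch `b` of the level tree at `P.vertex j` whose edge is fixed by `g`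
yields `ρ_j g = (ρ_j ∘ P.decompHom) (f · (if (π b).2 then up t else low (π b).1 t) · f⁻¹)` for some `f ∈ G`,
`t ∈ E` — VERBATIM the hypothesis `hstab` of `SemiGraph.ray_not_critical_of_characters` at `σ := ρ_j g`,
`ψ := ρ_j ∘ P.decompHom`, `σT := treeAct_j g`. [cite: MochizukiSemiAnbd2006, Rmk 2.2.1 p.24] -/
theorem thetaRay_hstab {w : ℕ} (P : D.PointSeq h𝒢 w) (j : ℕ) (g : D.temperedPi h𝒢) :
    ∀ b : (D.tree j).Branch, (D.tree j).abuts b = some (P.vertex j) →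
      (D.treeAct h𝒢 j g).hom.edgeMap ((D.tree j).edgeOf b) = (D.tree j).edgeOf b →
      ∃ (f : G) (t : E), D.proj h𝒢 j g = ((D.proj h𝒢 j).comp P.decompHom)
        (f * (if ((D.treeProj j).branchMap b).2 then up.toMonoidHom t
          else (low ((D.treeProj j).branchMap b).1).toMonoidHom t) * f⁻¹) := by
  intro b hb hfix
  have hbw : SemiGraph.ray.abuts ((D.treeProj j).branchMap b) = some w := by
    have h := (D.treeProj j).abuts_branchMap b (P.vertex j) hb
    rw [P.treeProj_vertexMap_vertex] at h
    exact h
  obtain ⟨f, t, hft⟩ :=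
    P.exists_gal_conj_brHom_of_edgeMap_eq j g ((D.treeProj j).branchMap b) hbw b rfl hb hfix
  refine ⟨f, t, ?_⟩
  have key : (thetaRay G E up low).brHom ((D.treeProj j).branchMap b) w hbw t =
      (if ((D.treeProj j).branchMap b).2 then up.toMonoidHom t
        else (low ((D.treeProj j).branchMap b).1).toMonoidHom t) :=
    thetaRay_brHom_apply_eq_ite (G := G) (E := E) (up := up) (low := low) _ w hbw t
  rw [hft]
  change P.gal j _ = P.gal j _
  rw [key]
  rfl

/-- **`hstab` at an arbitrary tree vertex of `𝒢_θ`**: given one point sequence `P₀` over `w`, every level-`j`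
tree vertex `y` over `w` carries a point sequence `P` through it (`P.vertex j = y`) for which `hstab` holds
at `y`. [cite: MochizukiSemiAnbd2006, Rmk 2.2.1 p.24] -/
theorem thetaRay_hstab_of_vertex {w : ℕ} (P₀ : D.PointSeq h𝒢 w) (j : ℕ) (y : (D.tree j).Vertex)
    (hy : (D.treeProj j).vertexMap y = w) (g : D.temperedPi h𝒢) :
    ∃ P : D.PointSeq h𝒢 w, P.vertex j = y ∧
      ∀ b : (D.tree j).Branch, (D.tree j).abuts b = some y →
        (D.treeAct h𝒢 j g).hom.edgeMap ((D.tree j).edgeOf b) = (D.tree j).edgeOf b →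
        ∃ (f : G) (t : E), D.proj h𝒢 j g = ((D.proj h𝒢 j).comp P.decompHom)
          (f * (if ((D.treeProj j).branchMap b).2 then up.toMonoidHom t
            else (low ((D.treeProj j).branchMap b).1).toMonoidHom t) * f⁻¹) := by
  obtain ⟨P, hP⟩ := P₀.exists_pointSeq_vertex_eq_of_treeProj j y hy
  refine ⟨P, hP, ?_⟩
  rw [← hP]
  exact thetaRay_hstab P j g

end Literature.AnabelianGeometry.SemiGraphs
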